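import Summits.HubbardSuperconductivity.HubbardSuperconductivity.Theses.LiebTwin
import Summits.HubbardSuperconductivity.HubbardSuperconductivity.Theorems.TwTipContinuation.Negative.TipNormalForm
import HarnessLib

/-!
# Route `LiebTwin`, support `UniformLROGivesSummitMatrix` (item `stmt-HubbardSuperconductivity-15381`)

Closes `Summit.HubbardSuperconductivity.HubbardSuperconductivity.Theses.LiebTwin.UniformLROGivesSummitMatrix`:
an eventual, uniform, every-ground-state floor `a·L⁴ ≤ Re⟨ψ, Δ_dᴴ Δ_d ψ⟩` at `(U, δ)` (even sides `L ≥ L₀`,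
every normalised `(N_L, 0)`-sector ground state of `hubbardTorus 2 L 1 U`, `N_L = 2⌊(1-δ)L²/2⌋`) gives the
summit's matrix at `(U, δ)`: every admissible ground-state sequence has d-wave pair-field long-range order
along the even sides `2k` (the `liminf` of `L⁻⁴ Σ_{x,y} C_d(x,y)` is positive).

This is the SHARED item of route `IntrinsicLargeN` (identical signature); the even-side `liminf`
bookkeeping is the tree lemma `TwTipContinuation.Negative.summitMatrix_of_everyGSOrder`
(file `Theorems/TwTipContinuation/Negative/TipNormalForm.lean`; its a-priori cap keeps Mathlib's real
`liminf` honest). Sources: Scalapino, Phys. Rep. **250** (1995) 329, §2 eq. (2.4); Friedli–Velenik (2017)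
§3.7.2 (LRO as a `liminf`). No definition and no named fact is introduced.
-/

-- the mandated namespace `Summit.<Summit>.<Problem>.Theorems` repeats `HubbardSuperconductivity`
-- (single-problem summit, D-0017), which the `dupNamespace` linter flags on every declaration
set_option linter.dupNamespace false

namespace Summit.HubbardSuperconductivity.HubbardSuperconductivity.Theorems

/-- **Uniform every-ground-state d-wave floor ⇒ the summit's matrix at `(U, δ)`** (route `LiebTwin`,
support `UniformLROGivesSummitMatrix`, item `stmt-HubbardSuperconductivity-15381`; shared verbatim with route
`IntrinsicLargeN`): if eventually in even `L` every normalised `(N_L, 0)`-sector ground state `ψ` of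
`hubbardTorus 2 L 1 U` has `a·L⁴ ≤ Re⟨ψ, (pairField dWaveFormFactor L)ᴴ (pairField dWaveFormFactor L) ψ⟩`
for some `a > 0`, then every admissible ground-state sequence has `HasLongRangeOrder` of the d-wave pair
field along the sides `2k` — the even-side `liminf` bookkeeping. Scalapino, Phys. Rep. 250 (1995) 329, §2.
[folklore] -/
theorem liebTwin_uniformLROGivesSummitMatrix_proof :
    Summit.HubbardSuperconductivity.HubbardSuperconductivity.Theses.LiebTwin.UniformLROGivesSummitMatrix := by
  intro U δ h
  exact Summit.HubbardSuperconductivity.TwTipContinuation.Negative.summitMatrix_of_everyGSOrder h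

end Summit.HubbardSuperconductivity.HubbardSuperconductivity.Theorems
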